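/-
Origin: expansion seat `planner-pub-hodgecm-carver-g2-0`, handover v3 2026-08-18 (`HOME/pub-hodgecm-carver-g2/lean/CarverG2/PerL34/AssemblyPrint.lean`, md5 11edfc4a, 76 lines);
landed by the gen-6 packager in gate run 22 as `HodgeCM/PerL34/AssemblyPrint.lean` (import ^import CarverG2\.PerL34\.→import HodgeCM.PerL34. ×1; import ^import Pv[0-9]+g[0-9]+\.PerL34\.→import HodgeCM.PerL34. ×1; import ^import Pv[0-9]+g[0-9]+\.→import HodgeCM.PerL34. ×1).
-/
/-
Copyright: publication cell pub-hodgecm (THE CARVER gen 2, planner-pub-hodgecm-carver-g2-0). Lean 4 / Mathlib.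

# `AssemblyPrint` — `perL_of_dictLeaves` with seam S6 (node N12a, `Open_thetaSub`) fed BY NAME through pv04-g2's
honest split `ThetaModel.open_thetaSub_of_split`, and seam S5 (34)-half (`N19g_core`) fed BY NAME through pv02-g2's
`QautDictionary.QautBridge` (LEMMAS.md v6 §9 S5/S6)

WIP imports (PACKAGER: rewrite `CarverG2.PerL34.AssemblyDict` → `HodgeCM.PerL34.AssemblyDict` (carver c085636a, run 22),
`Pv04g2.ThetaSubOfLiu` → `HodgeCM.PerL34.ThetaSubOfLiu` (pv04-g2 v3 824aff1d, run 22) and `Pv02g2.PerL34.QautDictionary` →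
`HodgeCM.PerL34.QautDictionary` (pv02-g2 2558dd61, run 22); lands AFTER all three).

NOTHING is cited or posited here.  Three theorems, one-line compositions: the binder `h12a : N12a_thetaSub T`
(= `T.Open_thetaSub` by `rfl`) of `perL_of_dictLeaves` is replaced by the two named inputs of pv04-g2's split —
`U.Fact_cmInflation` (model fact proposed as FACTS row M38 — pv04-g2 04:31:39Z; 'M31' in its first line collided with the reserved qw8 rows — PRINT: Shimura 1998 §6.2 Thm 3) and `T.Fact_thetaAlbanese` (PRINT-INTERFACE:
[Liu21] = arXiv:2102.11518 Prop 4.13 [p0020 L53–63] + Thm 4.18, read through the labelled dictionary R1–R4 of its docstring);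
`Fact_pull_comp`/`Fact_alphaLine` come from `M : U.ModelAxioms`, which the assembly already binds; and the binder `hcore`
(model-level (34)-core) is replaced by `hQ : ∀ good ctx, Nonempty (QautDictionary.QautBridge T V c (T.t34 V c) 2 3)` via
pv02-g2's KERNEL `QautDictionary.N19g_core_of_bridge` (join = PerL ll. 367–372 = `Qaut.pr_mul_eq_zero_of_weights` +
`Qaut.pr_mul_mem_span_wedge`).

Binder census of `perL_of_printDictLeaves` (every PerL v5 §§3–4 node fed BY NAME; what remains is PRINT or DICTIONARY):
`M : U.ModelAxioms`; PRINT leaves `h07 : N07_hodgeRiemann20 U`, `h09a : N09a_embCover T`, `h09b : N09b_innerEmb T`,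
`h12b : N12b_signRecipe T`, `hM38 : U.Fact_cmInflation`, `hAlb : T.Fact_thetaAlbanese`; seam S5 `hbr` ((12)-half: pv11's
`SeesawBridge`, dictionary fields `Λ_wedge`/`ϑ_period`) and `hQ` ((34)-half: pv02-g2's `QautBridge`, archimedean algebra shell
+ D4/D5 fields incl. the seesaw/K-type transport field); seam S4 `Pc A12 A34` (archimedean Lemma 4.1(c) data `ArchCDatum`);
seam S3 `h31 : ClusterOutputs T` (pv13); seams S1+S2 `h33 : CharSpans.CharSpanStepsInput T` (pv02-g2 over pv03/pv14).
-/
import Summits.HodgeConjecture.HodgeCM.PerL34.AssemblyDict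
import Summits.HodgeConjecture.HodgeCM.PerL34.ThetaSubOfLiu_2
import Summits.HodgeConjecture.HodgeCM.PerL34.QautDictionary

/-! PORT of `HodgeCM/PerL34/AssemblyPrint.lean` (HodgeCMPerL run 82) — verbatim mechanical port; provenance in the PORT header line. -/

set_option autoImplicit false

noncomputable section

namespace HodgeCM
namespace PerL34

open HodgeCM.Prior.Perl34File HodgeCM.Prior.Perl34File.Perl34 HodgeCM.PerL34.ArchC

variable {U : Universe}

/-- **N12a BY NAME** (seam S6): pv04-g2's split, in the carver's node vocabulary. -/
theorem N12a_thetaSub_of_split (M : U.ModelAxioms) (T : U.ThetaModel) (hM38 : U.Fact_cmInflation)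
    (hAlb : T.Fact_thetaAlbanese) : N12a_thetaSub T :=
  T.open_thetaSub_of_split M hM38 hAlb

/-- **N19g BY NAME from Qaut bridges** (seam S5, (34)-half): pv02-g2 `QautDictionary.open_thetaReal34_of_bridges`. -/
theorem N19g_genInWedgeSpan_of_bridges (T : U.ThetaModel)
    (hQ : ∀ {L : CMField} {ι₁ : L →+* ℂ} (V : HermSpace3 L ι₁) (c : SeesawCtx L), T.GoodCtx ι₁ c →
      Nonempty (QautDictionary.QautBridge T V c (T.t34 V c) 2 3)) : N19g_genInWedgeSpan T :=
  QautDictionary.open_thetaReal34_of_bridges T hQ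

/-- **PerL from PRINT leaves and DICTIONARY records (LEMMAS.md v6 §9): `perL_of_dictLeaves` with S6 and the S5 (34)-half
fed by name.** PROVED. -/
theorem perL_of_printDictLeaves (M : U.ModelAxioms) (T : U.ThetaModel)
    (h07 : N07_hodgeRiemann20 U) (h09a : N09a_embCover T) (h09b : N09b_innerEmb T)
    (hM38 : U.Fact_cmInflation) (hAlb : T.Fact_thetaAlbanese) (h12b : N12b_signRecipe T)
    (hbr : ∀ {L : CMField} {ι₁ : L →+* ℂ} (V : HermSpace3 L ι₁) (c : SeesawCtx L), T.GoodCtx ι₁ c →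
      Nonempty (SeesawDictionary.SeesawBridge T V c (T.t12 V c) 0 1))
    (hQ : ∀ {L : CMField} {ι₁ : L →+* ℂ} (V : HermSpace3 L ι₁) (c : SeesawCtx L), T.GoodCtx ι₁ c →
      Nonempty (QautDictionary.QautBridge T V c (T.t34 V c) 2 3))
    (Pc : ∀ {L : CMField} {ι₁ : L →+* ℂ} (V : HermSpace3 L ι₁) (c : SeesawCtx L),
      C4a.PointedCore (T.core V c))
    (A12 : ∀ {L : CMField} {ι₁ : L →+* ℂ} (V : HermSpace3 L ι₁) (c : SeesawCtx L),
      T.GoodCtx ι₁ c → Nonempty (ArchCDatum (T.core V c) (T.t12 V c) (Pc V c)))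
    (A34 : ∀ {L : CMField} {ι₁ : L →+* ℂ} (V : HermSpace3 L ι₁) (c : SeesawCtx L),
      T.GoodCtx ι₁ c → Nonempty (ArchCDatum (T.core V c) (T.t34 V c) (Pc V c)))
    (h31 : ClusterOutputs T) (h33 : CharSpans.CharSpanStepsInput T) : U.PerL :=
  perL_of_dictLeaves M T h07 h09a h09b (N12a_thetaSub_of_split M T hM38 hAlb) h12b hbr
    (fun V c hc => (hQ V c hc).elim fun B => QautDictionary.N19g_core_of_bridge B) Pc A12 A34 h31 h33

end PerL34
end HodgeCM

end
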